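import Literature.Computability.Complexity.StockmeyerEstimator
import Literature.Computability.Complexity.SamplingChernoff
import Literature.Computability.Complexity.PromiseBPPAmplification
import Literature.Computability.Complexity.UniformProbBlocks
import HarnessLib

/-!
# Set lower bounds by hashing coin blocks to zero: per-block densities and Chernoff over independent blocks

Trunk toolkit (theorems and two definitions), the probability half of a *bit-level* Goldwasser–Sipser
set lower-bound test run on a uniformly random COIN STRING cut into independent blocks — the form in
which an `NP` verifier reads it (S. Hirahara, ECCC TR21-058 (2021), proof of Lemma 4.5, p. 27: a
lower bound protocol `V((1ᵗ, K), y, r)` on coins `r ∼ {0,1}^{p(t)}` with completeness `≥ 1 - 2^{-t}`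
and soundness `< 2^{-t}`). The hash of a block is the affine map over `𝔽₂` that the tree's machines
evaluate (`Stockmeyer.coinHash b M κ'`: row `j` at coins `j(M+1) … j(M+1)+M`, `StockmeyerEstimator.lean`;
its `FP` test is `GSRef.hashOkFn`, `GoldwasserSipserRefereeBricks.lean`), the target is `0^{κ'}`:

* `HitZero T κ' b` — some `y ∈ T` (a set of bit vectors of length `M`) is hashed to `0` by the block
  `b`, in the bit-level form `Stockmeyer.HashesToZero` (`↔` the `𝔽₂` form, `hitZero_iff_exists_hash`);
* per-block densities from the per-target bounds of `AffineHashing.lean` and the equal-fibre lemma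
  `Stockmeyer.card_filter_coinHash`: with `κ' = κ + 1` output bits, **`density ≥ 3/8` if `|T| ≥ 2^κ`**
  (`card_hitZero_ge`) and **`density ≤ 1/4` if `2|T| ≤ 2^κ`** (`card_hitZero_le`), for every block
  length `B ≥ (κ+1)(M+1)`;
* generic Chernoff–Hoeffding corollaries for densities `≥ 3/8` / `≤ 1/4` and threshold `5u/16`
  (`card_fewGood_le_exp`, `card_manyGood_le_exp`: error `exp(-u/128)`, from `SamplingChernoff.lean`);
* **`uniformProb_fewHits_le_exp`** / **`uniformProb_manyHits_le_exp`** — for a uniformly random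
  `r ∈ {0,1}^{uB}` cut into `u` blocks (`(r ⇂ jB) ↾ B`), the probability of fewer than `5u/16`
  hitting blocks is `≤ exp(-u/128)` when `|T| ≥ 2^κ`, and of at least `5u/16` hitting blocks is
  `≤ exp(-u/128)` when `2|T| ≤ 2^κ` (blocks are independent uniform: `PromiseAmp.blockEquiv`, `block_ofFn`).

Written for the inline Lemma 4.5 of the proof plan of
`Literature.Computability.MetaComplexity.Hirahara2021_languageCompression`; independent of it.

## References

* S. Arora, B. Barak, *Computational Complexity: A Modern Approach*, CUP 2009, §8.2.2 (set lower
  bound protocol, Claim 8.16.1), Thm. 7.10 (Chernoff bound) [AroraBarakCC2009].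
* S. Goldwasser, M. Sipser, STOC 1986, §4.1 [GoldwasserSipser1986].
* S. Hirahara, ECCC TR21-058 (2021), proof of Lemma 4.5 (p. 27) [Hirahara2021].
-/

noncomputable section

namespace Literature.Computability.Complexity

open Finset Real Stockmeyer AffineHash PromiseAmp

open scoped Classical

/-! ### Generic Chernoff corollaries at densities `3/8` and `1/4`, threshold `5/16` -/

/-- If the good outcomes have density `≥ 3/8`, the `u`-sample sequences with fewer than `5u/16` good
samples number `≤ exp(-u/128) · |α|^u` (lower deviation `u/16`). [cite: AroraBarakCC2009, Thm. 7.10] -/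
theorem card_fewGood_le_exp {α : Type*} [Fintype α] [Nonempty α] (good : α → Prop) {u : ℕ} (hu : 0 < u)
    (hdens : (3 / 8 : ℝ) * Fintype.card α ≤ (univ.filter good).card) :
    ((univ.filter fun ω : Fin u → α => ((univ.filter fun i => good (ω i)).card : ℝ) < 5 / 16 * u).card : ℝ) ≤
      exp (-(u : ℝ) / 128) * Fintype.card (Fin u → α) := by
  have hdev := card_lowerDeviation_le_exp good hu (η := 1 / 16) (by norm_num)
  have hα : (0 : ℝ) < Fintype.card α := Nat.cast_pos.2 Fintype.card_pos
  have hp : (3 / 8 : ℝ) ≤ (univ.filter good).card / Fintype.card α := by rw [le_div_iff₀ hα]; linarith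
  have hsub : (univ.filter fun ω : Fin u → α => ((univ.filter fun i => good (ω i)).card : ℝ) < 5 / 16 * u) ⊆
      (univ.filter fun ω : Fin u → α => (u : ℝ) * (1 / 16) ≤
        u * ((univ.filter good).card / Fintype.card α) - ((univ.filter fun i => good (ω i)).card : ℝ)) := by
    intro ω hω
    rw [mem_filter] at hω ⊢
    refine ⟨mem_univ _, ?_⟩
    have hu' : (0 : ℝ) ≤ u := Nat.cast_nonneg u
    nlinarith [hω.2, mul_le_mul_of_nonneg_left hp hu']
  refine le_trans (by exact_mod_cast card_le_card hsub) (le_trans hdev (le_of_eq ?_))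
  congr 1
  congr 1
  ring

/-- If the good outcomes have density `≤ 1/4`, the `u`-sample sequences with at least `5u/16` good
samples number `≤ exp(-u/128) · |α|^u` (upper deviation `u/16`). [cite: AroraBarakCC2009, Thm. 7.10] -/
theorem card_manyGood_le_exp {α : Type*} [Fintype α] [Nonempty α] (good : α → Prop) {u : ℕ} (hu : 0 < u)
    (hdens : ((univ.filter good).card : ℝ) ≤ (1 / 4 : ℝ) * Fintype.card α) :
    ((univ.filter fun ω : Fin u → α => (5 / 16 : ℝ) * u ≤ ((univ.filter fun i => good (ω i)).card : ℝ)).card : ℝ) ≤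
      exp (-(u : ℝ) / 128) * Fintype.card (Fin u → α) := by
  have hdev := card_upperDeviation_le_exp good hu (η := 1 / 16) (by norm_num)
  have hα : (0 : ℝ) < Fintype.card α := Nat.cast_pos.2 Fintype.card_pos
  have hp : ((univ.filter good).card : ℝ) / Fintype.card α ≤ 1 / 4 := by rw [div_le_iff₀ hα]; linarith
  have hsub : (univ.filter fun ω : Fin u → α => (5 / 16 : ℝ) * u ≤ ((univ.filter fun i => good (ω i)).card : ℝ)) ⊆
      (univ.filter fun ω : Fin u → α => (u : ℝ) * (1 / 16) ≤
        ((univ.filter fun i => good (ω i)).card : ℝ) - u * ((univ.filter good).card / Fintype.card α)) := by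
    intro ω hω
    rw [mem_filter] at hω ⊢
    refine ⟨mem_univ _, ?_⟩
    have hu' : (0 : ℝ) ≤ u := Nat.cast_nonneg u
    nlinarith [hω.2, mul_le_mul_of_nonneg_left hp hu']
  refine le_trans (by exact_mod_cast card_le_card hsub) (le_trans hdev (le_of_eq ?_))
  congr 1
  congr 1
  ring

/-! ### Hashing a block to zero -/

/-- **Some element of `T` is hashed to `0^{κ'}` by the coin block `b`**, for a set `T` of bit vectors
of length `M`, in the bit-level form a machine checks (`Stockmeyer.HashesToZero`: every row parity of
the affine hash read off `b` vanishes). [cite: AroraBarakCC2009, §8.2.2 (set lower bound protocol, target 0)] -/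
def HitZero {M : ℕ} (T : Finset (List.Vector Bool M)) (κ' : ℕ) (b : List Bool) : Prop :=
  ∃ y ∈ T, HashesToZero b M κ' y.toList

/-- The `𝔽₂` reading: `HitZero T κ' b` iff some point of `toZ '' T` is hashed to `0` by
`Stockmeyer.coinHash b M κ'` (`hash_coinHash_eq_zero_iff`). [folklore] -/
theorem hitZero_iff_exists_hash {M : ℕ} (T : Finset (List.Vector Bool M)) (κ' : ℕ) (b : List Bool) :
    HitZero T κ' b ↔ ∃ x ∈ T.image Stockmeyer.toZ, hash (coinHash b M κ') x = 0 := by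
  constructor
  · rintro ⟨y, hy, h0⟩
    exact ⟨Stockmeyer.toZ y, mem_image_of_mem _ hy, (hash_coinHash_eq_zero_iff b y).2 h0⟩
  · rintro ⟨x, hx, h0⟩
    obtain ⟨y, hy, rfl⟩ := mem_image.1 hx
    exact ⟨y, hy, (hash_coinHash_eq_zero_iff b y).1 h0⟩

/-- `HitZero` is monotone in the set. [folklore] -/
theorem HitZero.mono {M : ℕ} {T T' : Finset (List.Vector Bool M)} (h : T' ⊆ T) {κ' : ℕ} {b : List Bool}
    (hb : HitZero T' κ' b) : HitZero T κ' b := by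
  obtain ⟨x, hx, h0⟩ := hb
  exact ⟨x, h hx, h0⟩

/-- `|toZ '' T| = |T|`. [folklore] -/
theorem card_image_toZ {M : ℕ} (T : Finset (List.Vector Bool M)) : (T.image Stockmeyer.toZ).card = T.card :=
  card_image_of_injective _ Stockmeyer.toZ_injective

/-! ### Per-block densities -/

section Density

variable {M κ B : ℕ}

/-- The number of hash functions (positive). [folklore] -/
theorem card_hash_pos (M κ' : ℕ) : 0 < Fintype.card (Hash M κ') := Fintype.card_pos

/-- **Density of hitting blocks, via the hash they define**: for `B ≥ κ'(M+1)`,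
`#{b ∈ {0,1}^B | HitZero T κ' b} · |H| = #{h | ∃ x ∈ toZ '' T, h(x) = 0} · 2^B`. [folklore] -/
theorem card_hitZero_mul {κ' : ℕ} (T : Finset (List.Vector Bool M)) (hB : κ' * (M + 1) ≤ B) :
    (univ.filter fun v : Fin B → Bool => HitZero T κ' (List.ofFn v)).card * Fintype.card (Hash M κ') =
      (univ.filter fun h : Hash M κ' => ∃ x ∈ T.image Stockmeyer.toZ, hash h x = 0).card * 2 ^ B := by
  have hvec : (univ.filter fun v : Fin B → Bool => HitZero T κ' (List.ofFn v)).card =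
      ((univ : Finset (List.Vector Bool B)).filter fun u : List.Vector Bool B =>
        (fun h : Hash M κ' => ∃ x ∈ T.image Stockmeyer.toZ, hash h x = 0) (coinHash u.toList M κ')).card :=
    card_equiv (Equiv.vectorEquivFin Bool B).symm fun v => by
      simp only [mem_filter, mem_univ, true_and, hitZero_iff_exists_hash, Equiv.vectorEquivFin, Equiv.coe_fn_symm_mk]
      rw [show (List.Vector.ofFn v : List.Vector Bool B).toList = List.ofFn v from List.Vector.toList_ofFn v]
  rw [hvec]
  convert Stockmeyer.card_filter_coinHash hB (fun h : Hash M κ' => ∃ x ∈ T.image Stockmeyer.toZ, hash h x = 0) using 4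

/-- **Completeness density**: if `|T| ≥ 2^κ` then at least `3/8` of the blocks `b ∈ {0,1}^B`
(`B ≥ (κ+1)(M+1)`) hit: `μ - μ²/2 = 1/2 - 1/8` for a subset of size exactly `2^κ` hashed to `κ+1` bits.
[cite: AroraBarakCC2009, Claim 8.16.1 (p. 187)] -/
theorem card_hitZero_ge (T : Finset (List.Vector Bool M)) (hT : 2 ^ κ ≤ T.card) (hB : (κ + 1) * (M + 1) ≤ B) :
    (3 / 8 : ℝ) * Fintype.card (Fin B → Bool) ≤
      ((univ.filter fun v : Fin B → Bool => HitZero T (κ + 1) (List.ofFn v)).card : ℝ) := by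
  obtain ⟨T', hT'T, hT'card⟩ := Finset.exists_subset_card_eq hT
  -- reduce to `T'` of size exactly `2^κ`
  have hmono : (univ.filter fun v : Fin B → Bool => HitZero T' (κ + 1) (List.ofFn v)).card ≤
      (univ.filter fun v : Fin B → Bool => HitZero T (κ + 1) (List.ofFn v)).card :=
    card_le_card fun v hv => by
      simp only [mem_filter, mem_univ, true_and] at hv ⊢
      exact hv.mono hT'T
  refine le_trans (b := ((univ.filter fun v : Fin B → Bool => HitZero T' (κ + 1) (List.ofFn v)).card : ℝ)) ?_
    (by exact_mod_cast hmono)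
  -- densities through the hash
  have hmul := card_hitZero_mul (κ' := κ + 1) T' hB
  have hge := card_exists_hash_ge (k := κ + 1) (T'.image Stockmeyer.toZ) 0
  rw [card_image_toZ, hT'card] at hge
  have hHpos : (0 : ℝ) < Fintype.card (Hash M (κ + 1)) := by exact_mod_cast card_hash_pos M (κ + 1)
  -- `hge : 2·2^κ·2^{κ+1}·H ≤ 2 N 4^{κ+1} + 2^κ (2^κ - 1) H`
  have hge' : (2 : ℝ) * 2 ^ κ * 2 ^ (κ + 1) * Fintype.card (Hash M (κ + 1)) ≤
      2 * ((univ.filter fun h : Hash M (κ + 1) => ∃ x ∈ T'.image Stockmeyer.toZ, hash h x = 0).card : ℝ) *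
          (2 ^ (κ + 1) * 2 ^ (κ + 1)) +
        2 ^ κ * ((2 ^ κ - 1 : ℕ) : ℝ) * Fintype.card (Hash M (κ + 1)) := by
    exact_mod_cast hge
  have hsub : ((2 ^ κ - 1 : ℕ) : ℝ) = 2 ^ κ - 1 := by
    rw [Nat.cast_sub (Nat.one_le_two_pow), Nat.cast_pow, Nat.cast_ofNat, Nat.cast_one]
  rw [hsub, pow_succ] at hge'
  -- from `hge'`: `3/8 · H ≤ N`
  have hNH : (3 / 8 : ℝ) * Fintype.card (Hash M (κ + 1)) ≤
      ((univ.filter fun h : Hash M (κ + 1) => ∃ x ∈ T'.image Stockmeyer.toZ, hash h x = 0).card : ℝ) := by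
    have h2 : (0 : ℝ) < 2 ^ κ := by positivity
    by_contra hlt
    push Not at hlt
    have h5 : (0 : ℝ) < 3 * Fintype.card (Hash M (κ + 1)) -
        8 * ((univ.filter fun h : Hash M (κ + 1) => ∃ x ∈ T'.image Stockmeyer.toZ, hash h x = 0).card : ℝ) := by
      linarith
    have hpos : (0 : ℝ) < 2 ^ κ * 2 ^ κ * (3 * Fintype.card (Hash M (κ + 1)) -
        8 * ((univ.filter fun h : Hash M (κ + 1) => ∃ x ∈ T'.image Stockmeyer.toZ, hash h x = 0).card : ℝ)) +
        2 ^ κ * Fintype.card (Hash M (κ + 1)) := by positivity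
    nlinarith [hge']
  -- transport to blocks: `card · H = N · 2^B`
  have hcardB : (Fintype.card (Fin B → Bool) : ℝ) = 2 ^ B := by simp
  have hmul' : ((univ.filter fun v : Fin B → Bool => HitZero T' (κ + 1) (List.ofFn v)).card : ℝ) *
      Fintype.card (Hash M (κ + 1)) =
      ((univ.filter fun h : Hash M (κ + 1) => ∃ x ∈ T'.image Stockmeyer.toZ, hash h x = 0).card : ℝ) * 2 ^ B := by
    exact_mod_cast hmul
  rw [hcardB]
  nlinarith [hmul', hNH, hHpos]

/-- **Soundness density**: if `2|T| ≤ 2^κ` then at most `1/4` of the blocks `b ∈ {0,1}^B`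
(`B ≥ (κ+1)(M+1)`) hit (union bound `μ ≤ 2^{κ-1}/2^{κ+1}`). [cite: AroraBarakCC2009, Claim 8.16.1 (p. 187)] -/
theorem card_hitZero_le (T : Finset (List.Vector Bool M)) (hT : 2 * T.card ≤ 2 ^ κ) (hB : (κ + 1) * (M + 1) ≤ B) :
    ((univ.filter fun v : Fin B → Bool => HitZero T (κ + 1) (List.ofFn v)).card : ℝ) ≤
      (1 / 4 : ℝ) * Fintype.card (Fin B → Bool) := by
  have hmul := card_hitZero_mul (κ' := κ + 1) T hB
  have hle := card_exists_hash_le (k := κ + 1) (T.image Stockmeyer.toZ) 0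
  rw [card_image_toZ] at hle
  have hHpos : (0 : ℝ) < Fintype.card (Hash M (κ + 1)) := by exact_mod_cast card_hash_pos M (κ + 1)
  have hle' : ((univ.filter fun h : Hash M (κ + 1) => ∃ x ∈ T.image Stockmeyer.toZ, hash h x = 0).card : ℝ) *
      2 ^ (κ + 1) ≤ T.card * Fintype.card (Hash M (κ + 1)) := by exact_mod_cast hle
  have hT' : (2 : ℝ) * T.card ≤ 2 ^ κ := by exact_mod_cast hT
  have hNH : ((univ.filter fun h : Hash M (κ + 1) => ∃ x ∈ T.image Stockmeyer.toZ, hash h x = 0).card : ℝ) ≤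
      (1 / 4 : ℝ) * Fintype.card (Hash M (κ + 1)) := by
    rw [pow_succ] at hle'
    have h2 : (0 : ℝ) < 2 ^ κ := by positivity
    nlinarith
  have hcardB : (Fintype.card (Fin B → Bool) : ℝ) = 2 ^ B := by simp
  have hmul' : ((univ.filter fun v : Fin B → Bool => HitZero T (κ + 1) (List.ofFn v)).card : ℝ) *
      Fintype.card (Hash M (κ + 1)) =
      ((univ.filter fun h : Hash M (κ + 1) => ∃ x ∈ T.image Stockmeyer.toZ, hash h x = 0).card : ℝ) * 2 ^ B := by
    exact_mod_cast hmul
  rw [hcardB]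
  nlinarith [hmul', hNH, hHpos]

end Density

/-! ### Independent blocks of a uniformly random coin string -/

section Blocks

variable {M κ B u : ℕ}

/-- The number of hitting blocks among the `u` blocks of length `B` of a coin string (block `j` is
`(r ⇂ jB) ↾ B`, the `HashBricks.blk r B j` of the machines). [folklore] -/
def hitBlocks (T : Finset (List.Vector Bool M)) (κ' B u : ℕ) (r : List Bool) : ℕ :=
  (univ.filter fun j : Fin u => HitZero T κ' ((r.drop (j * B)).take B)).card

/-- The blocks of `ofFn f` are the `ofFn` of the blocks of `f`. [folklore] -/
theorem hitBlocks_ofFn (T : Finset (List.Vector Bool M)) (κ' : ℕ) (f : Fin (u * B) → Bool) :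
    hitBlocks T κ' B u (List.ofFn f) =
      (univ.filter fun j : Fin u => HitZero T κ' (List.ofFn (blockEquiv u B f j))).card := by
  unfold hitBlocks
  congr 1
  refine filter_congr fun j _ => ?_
  rw [block_ofFn]

/-- **Completeness over independent blocks**: if `|T| ≥ 2^κ`, `B ≥ (κ+1)(M+1)` and `u ≥ 1`, then a
uniformly random `r ∈ {0,1}^{uB}` has fewer than `5u/16` hitting blocks with probability
`≤ exp(-u/128)`. [cite: AroraBarakCC2009, §8.2.2 (amplified set lower bound protocol) with Thm. 7.10] -/
theorem uniformProb_fewHits_le_exp (T : Finset (List.Vector Bool M)) (hT : 2 ^ κ ≤ T.card)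
    (hB : (κ + 1) * (M + 1) ≤ B) (hu : 0 < u) :
    uniformProb (u * B) {r | (hitBlocks T (κ + 1) B u r : ℝ) < 5 / 16 * u} ≤ exp (-(u : ℝ) / 128) := by
  rw [uniformProb_eq_card_fun, div_le_iff₀ (by positivity)]
  have hdens := card_hitZero_ge T hT hB
  have hch := card_fewGood_le_exp (fun v : Fin B → Bool => HitZero T (κ + 1) (List.ofFn v)) hu hdens
  refine (le_of_eq ?_).trans (hch.trans (le_of_eq ?_))
  · exact_mod_cast card_equiv (blockEquiv u B) fun f => by
      simp only [mem_filter, mem_univ, true_and, Set.mem_setOf_eq, hitBlocks_ofFn]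
  · rw [Fintype.card_fun, Fintype.card_fun, Fintype.card_fin, Fintype.card_fin, Fintype.card_bool]
    push_cast
    rw [← pow_mul, mul_comm B u]

/-- **Soundness over independent blocks**: if `2|T| ≤ 2^κ`, `B ≥ (κ+1)(M+1)` and `u ≥ 1`, then a
uniformly random `r ∈ {0,1}^{uB}` has at least `5u/16` hitting blocks with probability
`≤ exp(-u/128)`. [cite: AroraBarakCC2009, §8.2.2 (amplified set lower bound protocol) with Thm. 7.10] -/
theorem uniformProb_manyHits_le_exp (T : Finset (List.Vector Bool M)) (hT : 2 * T.card ≤ 2 ^ κ)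
    (hB : (κ + 1) * (M + 1) ≤ B) (hu : 0 < u) :
    uniformProb (u * B) {r | (5 / 16 : ℝ) * u ≤ hitBlocks T (κ + 1) B u r} ≤ exp (-(u : ℝ) / 128) := by
  rw [uniformProb_eq_card_fun, div_le_iff₀ (by positivity)]
  have hdens := card_hitZero_le T hT hB
  have hch := card_manyGood_le_exp (fun v : Fin B → Bool => HitZero T (κ + 1) (List.ofFn v)) hu hdens
  refine (le_of_eq ?_).trans (hch.trans (le_of_eq ?_))
  · exact_mod_cast card_equiv (blockEquiv u B) fun f => by
      simp only [mem_filter, mem_univ, true_and, Set.mem_setOf_eq, hitBlocks_ofFn]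
  · rw [Fintype.card_fun, Fintype.card_fun, Fintype.card_fin, Fintype.card_fin, Fintype.card_bool]
    push_cast
    rw [← pow_mul, mul_comm B u]

end Blocks

end Literature.Computability.Complexity
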